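import Literature.NumberTheory.Rogawski1990.ArchEndoscopicTransferContinuousGWall        -- ★ LH3-p04 (g2) p849710 (M2-01-curve): brings ★ p849548 (Δ-def-explicit) and the curve bookkeeping
import HarnessLib

/-!
# (M3-pre) Across the `H`-wall `z₀ = z₂` at ANY place: `2 sin ψ · (Δ″-side of Θ)` has ONE-SIDED limits of orders 0 and 1 along the normal curve — the `H`-side jump in closed form
# (Rogawski 1990 §4.9 p. 55, §8.2 pp. 119–124; Shelstad 1979 §4; Varadarajan 1989 §6.4 Thms 18, 20, 22)

Topic `NumberTheory/Rogawski1990`; namespace `Literature.NumberTheory.Rogawski1990`.  THEOREMS ONLY (no `def`, no instance, no notation, no axiom, no named fact, no `sorry`).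
Cell `pub/hodgecm-mathlib`, line LH3 (closer stub `stub_N9`, crux H413 = `stmt-HodgeConjecture-24833`), `H`-side input of organ **(M3)** of LH3-plan (g2)'s D2′-SPEC §3∕§3b («H-WALL
`z₀ = z₂`: κ EQUAL across it, the jumps ADD: `2iκ(A)·(R′F)(D)(cayPt)` … = H-side stable jump `2i·Transf(insert w S)(cayPt)`»).  Companions: ★ p849710 (M2-01-curve: the `G`-walls,
two-sided limits) and ★ `ArchEndoscopicTransferSmoothDefinitePlace` (the `H`-wall at a definite place, two-sided limits).  Here: the `H`-wall at a place of ANY signature — the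
one-sided structure that (I₁)∕(I₃) of D2′-SPEC consume; the identification of the jump with the split-chart family is the planner's (M3) proper (jcH currency).

SETTING.  Base `z` regular off `w`, `z_{w,0} = z_{w,2} ≠ z_{w,1}`, curve `z^ψ = update z w (i ↦ z_{w,i}e^{i(1,0,−1)_iψ})`, `H`-point `γ_H(z^ψ)` (its 2-block eigenvalues `ζ₀e^{±iψ}`
coalesce at `ψ = 0`), partners `t(z^ψ∘ρ)`; `G(ψ) := 2 sin ψ · Σ_ρ Δ″(γ_H(z^ψ), t(z^ψ∘ρ))·∫_{G′_∞} Θ(↑↑(g·t(z^ψ∘ρ)·g⁻¹)) dν_∞` — the factor `2 sin ψ` is (up to a unit) the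
`H`-root factor `1 − e^{−i(c₀−c₂)}` of the normaliser `R_H`, which tames the `1∕ψ` growth of the unstable orbital integrals at a noncompact wall.

THE MATHEMATICS.  `Δ″_ρ = K_ρ·(τ·D)(γ_H(z^ψ))` (★ p849548) with `(τ·D)(ψ) = S(ψ) = C·(−((ζ₀²)^k(ζ₁ − ζ₀e^{iψ})(ζ₁ − ζ₀e^{−iψ}))∕ζ₁)` ENTIRE (`z₀z₂ = ζ₀²` constant on the curve); so
`G = S · Σ_ρ K_ρ g_ρ`, `g_ρ = 2 sin ψ·O_ρ` with three limits `Jp_ρ, Jm_ρ, D_ρ` for EVERY partner (noncompact `w`-wall: ★ (C-bdry-glob) p849626; compact: ★ brick A p849649,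
`Jp_ρ = Jm_ρ = 0`).  Hence `G(0±) = S(0)·Σ_ρ K_ρ J±_ρ` and `G′(0±) = S′(0)·Σ_ρ K_ρ J±_ρ + S(0)·Σ_ρ K_ρ D_ρ`: the JUMP is `G(0+) − G(0−) = S(0)·Σ_ρ K_ρ(Jp_ρ − Jm_ρ)` — no
cancellation here (★ `archExplicitDelta_cayleyTorus_mirror02`: mirror partners across the `H`-wall have EQUAL `K`), in contrast with the `G`-walls (★ p849710).

WHAT IS PROVED.  **`exists_tendsto_two_sin_mul_sum_archExplicitDelta_mul_integral_splitCurve_hWall`** (+ `_aux`): `∃ Jp Jm Bp Bm`, one-sided limits of `G` and of `G′` at `ψ = 0±`.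
HONEST LABEL: HC_CM is proved only modulo the 7 printed citations (2 remaining: hLiu418 = stmt-HodgeConjecture-24832, h413 = stmt-HodgeConjecture-24833) until rung 0 closes; input of
(M3), pays nothing by itself.

## References
* [Rogawski1990] J. D. Rogawski, *Automorphic Representations of Unitary Groups in Three Variables*, Ann. of Math. Stud. 123 (1990), §4.9 p. 55, §8.2 pp. 119–124.
* [Shelstad1979] D. Shelstad, *Characters and inner forms of a quasi-split group over ℝ*, Compositio Math. 39 (1979), §4.
* [Varadarajan1989] V. S. Varadarajan, *An Introduction to Harmonic Analysis on Semisimple Lie Groups* (1989), §6.4 Thm 18, Thm 20, Thm 22.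
-/

set_option autoImplicit false

noncomputable section

open MeasureTheory Measure Filter Topology NumberField NumberField.InfinitePlace NumberField.mixedEmbedding Equiv Function Set
open Literature.MeasureTheory.Group Literature.NumberTheory.Automorphic Literature.NumberTheory.Automorphic.UnitaryGroup Literature.NumberTheory.GaloisRepresentations
open Literature.LinearAlgebra.Matrix
open scoped Matrix MatrixGroups Matrix.Norms.Operator ContDiff ComplexConjugate

namespace Literature.NumberTheory.Rogawski1990

section HWall

variable (L : Type) [Field L] [NumberField L] [IsCMField L] (α : Fin 3 → L) (w : {w : InfinitePlace L // IsComplex w})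
  [MeasurableSpace (GL (Fin 3) ℂ)] [BorelSpace (GL (Fin 3) ℂ)]
  [MeasurableSpace (arch (↥(maximalRealSubfield L)) L (IsCMField.complexConj L) 3 (Matrix.diagonal α))] [BorelSpace (arch (↥(maximalRealSubfield L)) L (IsCMField.complexConj L) 3 (Matrix.diagonal α))]

variable
  (γH : ({w : InfinitePlace L // IsComplex w} → Fin 3 → Circle) →
    ↥(UnitaryGroup.arch (↥(maximalRealSubfield L)) L (IsCMField.complexConj L) 2
        (Matrix.of fun i j : Fin 2 => if i.val + j.val + 1 = 2 then (1 : L) else 0)) ×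
      ↥(UnitaryGroup.arch (↥(maximalRealSubfield L)) L (IsCMField.complexConj L) 1
        (Matrix.of fun i j : Fin 1 => if i.val + j.val + 1 = 1 then (1 : L) else 0)))
  (hγH : γH = fun z =>
    ((UnitaryGroup.archPiEquivCM 2 L (Matrix.of fun i j : Fin 2 => if i.val + j.val + 1 = 2 then (1 : L) else 0)).symm fun w =>
        ⟨Matrix.GeneralLinearGroup.mkOfDetNeZero !![(1 : ℂ), 1; 1, -1] UnitaryGroup.det_cayleyTwo_ne_zero *
            UnitaryGroup.circleDiagonal 2 ![z w 0, z w 2] *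
          (Matrix.GeneralLinearGroup.mkOfDetNeZero !![(1 : ℂ), 1; 1, -1] UnitaryGroup.det_cayleyTwo_ne_zero)⁻¹,
          UnitaryGroup.cayley_conj_circleDiagonal_mem_archLocal L w _⟩,
      (UnitaryGroup.archPiEquivCM 1 L (Matrix.of fun i j : Fin 1 => if i.val + j.val + 1 = 1 then (1 : L) else 0)).symm fun w =>
        ⟨UnitaryGroup.circleDiagonal 1 ![z w 1], UnitaryGroup.circleDiagonal_mem_archLocal_antidiagOne L w _⟩))
  (μ : HeckeCharacter L)

include hγH in
open scoped Classical in
/-- (M3-pre) with the curve as an equality binder (proof engine; instantiate with `rfl`). [cite: Rogawski1990, §8.2 pp. 122–124] [cite: Shelstad1979, §4] [cite: Varadarajan1989, §6.4 Thm 18, Thm 20, Thm 22] -/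
theorem exists_tendsto_two_sin_mul_sum_archExplicitDelta_mul_integral_splitCurve_hWall_aux
    (νw : ∀ v : {w : InfinitePlace L // IsComplex w}, Measure (archLocal L 3 (Matrix.diagonal α) v)) [∀ v, (νw v).IsHaarMeasure]
    (hα : ∀ i, α i ≠ 0) (hherm : ∀ i, (IsCMField.complexConj L (α i) : L) = α i)
    (hμω : ∀ x : ideleGroup ↥(maximalRealSubfield L), μ (AdeleRing.ideleBaseChange (↥(maximalRealSubfield L)) L x) = quadraticHeckeCharCM L x)
    (Θ : Matrix (Fin 3) (Fin 3) (mixedSpace L) → ℂ) (hΘ : ContDiff ℝ (⊤ : ℕ∞) Θ)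
    (hΘc : HasCompactSupport fun g : arch (↥(maximalRealSubfield L)) L (IsCMField.complexConj L) 3 (Matrix.diagonal α) => Θ ((g : GL (Fin 3) (mixedSpace L)) : Matrix (Fin 3) (Fin 3) (mixedSpace L)))
    (z : {w : InfinitePlace L // IsComplex w} → Fin 3 → Circle) (hz : ∀ v, v ≠ w → Function.Injective (z v)) (h02 : z w 0 = z w 2) (h01 : z w 0 ≠ z w 1)
    (c : ℝ → Fin 3 → Circle) (hc : c = fun ψ i => z w i * Circle.exp (![(1 : ℝ), 0, -1] i * ψ)) :
    ∃ Jp Jm Bp Bm : ℂ,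
      Tendsto (fun ψ : ℝ => (2 * Real.sin ψ : ℂ) * ∑ ρ : {w : InfinitePlace L // IsComplex w} → Perm (Fin 3),
          archExplicitDelta L (Matrix.diagonal α) (γH fun v => Function.update z w (c ψ) v) μ (archDiagTorus L 3 α fun v => Function.update z w (c ψ) v ∘ ⇑(ρ v)) *
            ∫ g, Θ (((g * archDiagTorus L 3 α (fun v => Function.update z w (c ψ) v ∘ ⇑(ρ v)) * g⁻¹ :
              arch (↥(maximalRealSubfield L)) L (IsCMField.complexConj L) 3 (Matrix.diagonal α)) : GL (Fin 3) (mixedSpace L)) : Matrix (Fin 3) (Fin 3) (mixedSpace L))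
              ∂((Measure.pi νw).map (archPiEquivCM 3 L (Matrix.diagonal α)).symm)) (𝓝[>] 0) (𝓝 Jp) ∧
      Tendsto (fun ψ : ℝ => (2 * Real.sin ψ : ℂ) * ∑ ρ : {w : InfinitePlace L // IsComplex w} → Perm (Fin 3),
          archExplicitDelta L (Matrix.diagonal α) (γH fun v => Function.update z w (c ψ) v) μ (archDiagTorus L 3 α fun v => Function.update z w (c ψ) v ∘ ⇑(ρ v)) *
            ∫ g, Θ (((g * archDiagTorus L 3 α (fun v => Function.update z w (c ψ) v ∘ ⇑(ρ v)) * g⁻¹ :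
              arch (↥(maximalRealSubfield L)) L (IsCMField.complexConj L) 3 (Matrix.diagonal α)) : GL (Fin 3) (mixedSpace L)) : Matrix (Fin 3) (Fin 3) (mixedSpace L))
              ∂((Measure.pi νw).map (archPiEquivCM 3 L (Matrix.diagonal α)).symm)) (𝓝[<] 0) (𝓝 Jm) ∧
      Tendsto (fun ψ : ℝ => deriv (fun ψ : ℝ => (2 * Real.sin ψ : ℂ) * ∑ ρ : {w : InfinitePlace L // IsComplex w} → Perm (Fin 3),
          archExplicitDelta L (Matrix.diagonal α) (γH fun v => Function.update z w (c ψ) v) μ (archDiagTorus L 3 α fun v => Function.update z w (c ψ) v ∘ ⇑(ρ v)) *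
            ∫ g, Θ (((g * archDiagTorus L 3 α (fun v => Function.update z w (c ψ) v ∘ ⇑(ρ v)) * g⁻¹ :
              arch (↥(maximalRealSubfield L)) L (IsCMField.complexConj L) 3 (Matrix.diagonal α)) : GL (Fin 3) (mixedSpace L)) : Matrix (Fin 3) (Fin 3) (mixedSpace L))
              ∂((Measure.pi νw).map (archPiEquivCM 3 L (Matrix.diagonal α)).symm)) ψ) (𝓝[>] 0) (𝓝 Bp) ∧
      Tendsto (fun ψ : ℝ => deriv (fun ψ : ℝ => (2 * Real.sin ψ : ℂ) * ∑ ρ : {w : InfinitePlace L // IsComplex w} → Perm (Fin 3),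
          archExplicitDelta L (Matrix.diagonal α) (γH fun v => Function.update z w (c ψ) v) μ (archDiagTorus L 3 α fun v => Function.update z w (c ψ) v ∘ ⇑(ρ v)) *
            ∫ g, Θ (((g * archDiagTorus L 3 α (fun v => Function.update z w (c ψ) v ∘ ⇑(ρ v)) * g⁻¹ :
              arch (↥(maximalRealSubfield L)) L (IsCMField.complexConj L) 3 (Matrix.diagonal α)) : GL (Fin 3) (mixedSpace L)) : Matrix (Fin 3) (Fin 3) (mixedSpace L))
              ∂((Measure.pi νw).map (archPiEquivCM 3 L (Matrix.diagonal α)).symm)) ψ) (𝓝[<] 0) (𝓝 Bm) := by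
  -- ABBREVIATIONS (opaque, with defining equations): the orbital function `g_ρ`, the sign product `K_ρ`
  obtain ⟨G, hG⟩ : ∃ G : ({w : InfinitePlace L // IsComplex w} → Perm (Fin 3)) → ℝ → ℂ, G = fun (ρ : {w : InfinitePlace L // IsComplex w} → Perm (Fin 3)) (ψ : ℝ) => (2 * Real.sin ψ : ℂ) *
      ∫ g, Θ (((g * archDiagTorus L 3 α (fun v => Function.update z w (c ψ) v ∘ ⇑(ρ v)) * g⁻¹ :
        arch (↥(maximalRealSubfield L)) L (IsCMField.complexConj L) 3 (Matrix.diagonal α)) : GL (Fin 3) (mixedSpace L)) : Matrix (Fin 3) (Fin 3) (mixedSpace L))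
        ∂((Measure.pi νw).map (archPiEquivCM 3 L (Matrix.diagonal α)).symm) := ⟨_, rfl⟩
  obtain ⟨K, hK⟩ : ∃ K : ({w : InfinitePlace L // IsComplex w} → Perm (Fin 3)) → ℤ, ∀ ρ, K ρ =
      (∏ v : {w : InfinitePlace L // IsComplex w}, ((SignType.sign ((v.1.embedding (α ((ρ v).symm 1))).re) : ℤ) * archMajoritySign L (Matrix.diagonal α) v)) :=
    ⟨fun ρ => _, fun ρ => rfl⟩
  have hGρ : ∀ ρ : {w : InfinitePlace L // IsComplex w} → Perm (Fin 3), G ρ = fun ψ : ℝ => (2 * Real.sin ψ : ℂ) *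
      ∫ g, Θ (((g * archDiagTorus L 3 α (fun v => Function.update z w (fun i => z w i * Circle.exp (![(1 : ℝ), 0, -1] i * ψ)) v ∘ ⇑(ρ v)) * g⁻¹ :
        arch (↥(maximalRealSubfield L)) L (IsCMField.complexConj L) 3 (Matrix.diagonal α)) : GL (Fin 3) (mixedSpace L)) : Matrix (Fin 3) (Fin 3) (mixedSpace L))
        ∂((Measure.pi νw).map (archPiEquivCM 3 L (Matrix.diagonal α)).symm) := by
    intro ρ; subst hc hG; rfl
  have hcψ : ∀ ψ : ℝ, c ψ = fun i => z w i * Circle.exp (![(1 : ℝ), 0, -1] i * ψ) := fun ψ => by subst hc; rfl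
  have hreal : ∀ i, (w.1.embedding (α i)).im = 0 := fun i => im_embedding_eq_zero_of_complexConj_eq L w (hherm i)
  have hne : ∀ i, (w.1.embedding (α i)).re ≠ 0 := fun i h =>
    hα i (w.1.embedding.injective (by rw [map_zero]; exact Complex.ext h (hreal i)))
  have h12 : z w 1 ≠ z w 2 := fun h => h01 (h02.trans h.symm)
  -- (1) PER-PARTNER LIMITS: `Jp, Jm, D`, with `Jp = Jm = 0` at a compact wall
  have hlim : ∀ ρ : {w : InfinitePlace L // IsComplex w} → Perm (Fin 3), ∃ Jp Jm D : ℂ,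
      Tendsto (G ρ) (𝓝[>] 0) (𝓝 Jp) ∧ Tendsto (G ρ) (𝓝[<] 0) (𝓝 Jm) ∧ Tendsto (fun ψ => deriv (G ρ) ψ) (𝓝[≠] 0) (𝓝 D) ∧
        (0 < (w.1.embedding (α ((ρ w)⁻¹ 0))).re * (w.1.embedding (α ((ρ w)⁻¹ 2))).re → Jp = 0 ∧ Jm = 0) := by
    intro ρ
    rw [hGρ ρ]
    rcases lt_or_gt_of_ne (mul_ne_zero (hne ((ρ w)⁻¹ 0)) (hne ((ρ w)⁻¹ 2))) with hnc | hpos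
    · obtain ⟨Jp, Jm, D, hJp, hJm, hD⟩ := exists_tendsto_two_sin_mul_integral_comp_conj_archDiagTorus_update_splitCurve_comp L α w νw hα hherm Θ hΘ hΘc z hz h02 h01 ρ hnc
      exact ⟨Jp, Jm, D, hJp, hJm, hD, fun h => absurd hnc (not_lt.mpr h.le)⟩
    · obtain ⟨h0, D, hD⟩ := tendsto_two_sin_mul_integral_comp_conj_archDiagTorus_update_splitCurve_comp_of_pos L α w νw hα hherm Θ hΘ hΘc z hz h02 h01 ρ hpos
      exact ⟨0, 0, D, h0.mono_left (nhdsWithin_mono _ fun x hx => ne_of_gt hx), h0.mono_left (nhdsWithin_mono _ fun x hx => ne_of_lt hx), hD, fun _ => ⟨rfl, rfl⟩⟩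
  choose Jp Jm D hJp hJm hD hcw using hlim
  -- (2) THE LAURENT FORM OF `τ·D` ALONG THE CURVE: `= S(ψ)` with `S` entire (no zero at the `H`-wall: `z₀z₂ = ζ₀²` is constant)
  obtain ⟨k, hk⟩ := exists_archTau_mul_archWeylRatio_cayleyTorus_eq L γH hγH μ hμω
  obtain ⟨Cst, hCst⟩ : ∃ Cst : ℂ, Cst = (∏ v ∈ Finset.univ.erase w, -((((z v 0 : ℂ) * (z v 2 : ℂ)) ^ (k v)) * (((z v 1 : ℂ) - (z v 0 : ℂ)) * ((z v 1 : ℂ) - (z v 2 : ℂ))) / (z v 1 : ℂ))) :=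
    ⟨_, rfl⟩
  obtain ⟨S, hS⟩ : ∃ S : ℝ → ℂ, S = fun ψ : ℝ => Cst * -(((((z w 0 : ℂ) * (z w 0 : ℂ)) ^ (k w)) *
      ((((z w 1 : ℂ) - (z w 0 : ℂ) * Complex.exp (ψ * Complex.I)) * ((z w 1 : ℂ) - (z w 0 : ℂ) * Complex.exp (-(ψ * Complex.I)))))) / (z w 1 : ℂ)) := ⟨_, rfl⟩
  have hS_smooth : ContDiff ℝ (⊤ : ℕ∞) S := by
    have h1 : ContDiff ℝ (⊤ : ℕ∞) (fun ψ : ℝ => (ψ : ℂ)) := Complex.ofRealCLM.contDiff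
    have hA : ContDiff ℝ (⊤ : ℕ∞) (fun ψ : ℝ => Complex.exp (ψ * Complex.I)) := Complex.contDiff_exp.comp (h1.mul contDiff_const)
    have hB : ContDiff ℝ (⊤ : ℕ∞) (fun ψ : ℝ => Complex.exp (-(ψ * Complex.I))) := Complex.contDiff_exp.comp (h1.mul contDiff_const).neg
    rw [hS]
    simp only [div_eq_mul_inv]
    exact contDiff_const.mul ((contDiff_const.mul ((contDiff_const.sub (contDiff_const.mul hA)).mul (contDiff_const.sub (contDiff_const.mul hB)))).mul contDiff_const).neg
  have hc0 : ∀ ψ : ℝ, ((c ψ 0 : Circle) : ℂ) = (z w 0 : ℂ) * Complex.exp (ψ * Complex.I) := by intro ψ; subst hc; simp [Circle.coe_exp]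
  have hc1 : ∀ ψ : ℝ, ((c ψ 1 : Circle) : ℂ) = (z w 1 : ℂ) := by intro ψ; subst hc; simp
  have hc2 : ∀ ψ : ℝ, ((c ψ 2 : Circle) : ℂ) = (z w 0 : ℂ) * Complex.exp (-(ψ * Complex.I)) := by intro ψ; subst hc; simp [Circle.coe_exp, h02, Complex.exp_neg]
  have hT : ∀ ψ : ℝ, archTau L (γH fun v => Function.update z w (c ψ) v) μ * (archWeylRatio L (γH fun v => Function.update z w (c ψ) v) : ℂ) = S ψ := by
    intro ψ
    rw [hk, ← Finset.mul_prod_erase Finset.univ _ (Finset.mem_univ w), Function.update_self, hc0, hc1, hc2,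
      Finset.prod_congr rfl fun v hv => by rw [Function.update_of_ne (Finset.ne_of_mem_erase hv)], hS, hCst]
    have he : Complex.exp (ψ * Complex.I) * Complex.exp (-(ψ * Complex.I)) = 1 := by rw [← Complex.exp_add, add_neg_cancel, Complex.exp_zero]
    have hsq : ((z w 0 : ℂ) * Complex.exp (ψ * Complex.I)) * ((z w 0 : ℂ) * Complex.exp (-(ψ * Complex.I))) = (z w 0 : ℂ) * (z w 0 : ℂ) := by
      linear_combination ((z w 0 : ℂ) * (z w 0 : ℂ)) * he
    rw [hsq]
    ring
  -- (3) `Δ″`-TERMS AND `G = S · H`, `H = Σ_ρ K_ρ g_ρ`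
  have hΔ : ∀ (ρ : {w : InfinitePlace L // IsComplex w} → Perm (Fin 3)) (ψ : ℝ),
      archExplicitDelta L (Matrix.diagonal α) (γH fun v => Function.update z w (c ψ) v) μ (archDiagTorus L 3 α fun v => Function.update z w (c ψ) v ∘ ⇑(ρ v)) =
        (K ρ : ℂ) * S ψ := by
    intro ρ ψ
    rw [archExplicitDelta_cayleyTorus_relabel_eq_mul L α γH hγH μ (fun v => Function.update z w (c ψ) v) ρ, hT ψ, hK ρ]
  have hF : (fun ψ : ℝ => (2 * Real.sin ψ : ℂ) * ∑ ρ : {w : InfinitePlace L // IsComplex w} → Perm (Fin 3),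
          archExplicitDelta L (Matrix.diagonal α) (γH fun v => Function.update z w (c ψ) v) μ (archDiagTorus L 3 α fun v => Function.update z w (c ψ) v ∘ ⇑(ρ v)) *
            ∫ g, Θ (((g * archDiagTorus L 3 α (fun v => Function.update z w (c ψ) v ∘ ⇑(ρ v)) * g⁻¹ :
              arch (↥(maximalRealSubfield L)) L (IsCMField.complexConj L) 3 (Matrix.diagonal α)) : GL (Fin 3) (mixedSpace L)) : Matrix (Fin 3) (Fin 3) (mixedSpace L))
              ∂((Measure.pi νw).map (archPiEquivCM 3 L (Matrix.diagonal α)).symm)) =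
      fun ψ => S ψ * ∑ ρ : {w : InfinitePlace L // IsComplex w} → Perm (Fin 3), (K ρ : ℂ) * G ρ ψ := by
    funext ψ
    rw [Finset.mul_sum, Finset.mul_sum]
    refine Finset.sum_congr rfl fun ρ _ => ?_
    rw [hΔ ρ ψ, hG]
    ring
  rw [hF]
  -- (4) LIMITS OF `H` (one-sided) AND `H′` (two-sided)
  have hTev : ∀ᶠ ψ in 𝓝[≠] (0 : ℝ), Function.Injective (c ψ) := by
    simp only [hcψ]; exact eventually_injective_splitCurve (z w) h02 h01
  have hGdiff : ∀ ρ : {w : InfinitePlace L // IsComplex w} → Perm (Fin 3), ∀ ψ : ℝ, Function.Injective (c ψ) → DifferentiableAt ℝ (G ρ) ψ := by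
    intro ρ ψ hψ
    rw [hGρ ρ]
    rw [hcψ ψ] at hψ
    exact differentiableAt_two_sin_mul_integral_comp_conj_archDiagTorus_update_splitCurve_comp L α w νw hα hherm Θ hΘ hΘc z hz ρ hψ
  have hGT : (𝓝[>] (0 : ℝ)) ≤ 𝓝[≠] 0 := nhdsWithin_mono _ fun x hx => ne_of_gt hx
  have hLT : (𝓝[<] (0 : ℝ)) ≤ 𝓝[≠] 0 := nhdsWithin_mono _ fun x hx => ne_of_lt hx
  have hHp : Tendsto (fun ψ => ∑ ρ : {w : InfinitePlace L // IsComplex w} → Perm (Fin 3), (K ρ : ℂ) * G ρ ψ) (𝓝[>] 0) (𝓝 (∑ ρ, (K ρ : ℂ) * Jp ρ)) :=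
    tendsto_finsetSum _ fun ρ _ => (hJp ρ).const_mul _
  have hHm : Tendsto (fun ψ => ∑ ρ : {w : InfinitePlace L // IsComplex w} → Perm (Fin 3), (K ρ : ℂ) * G ρ ψ) (𝓝[<] 0) (𝓝 (∑ ρ, (K ρ : ℂ) * Jm ρ)) :=
    tendsto_finsetSum _ fun ρ _ => (hJm ρ).const_mul _
  have hHderiv : ∀ ψ : ℝ, Function.Injective (c ψ) →
      HasDerivAt (fun ψ => ∑ ρ : {w : InfinitePlace L // IsComplex w} → Perm (Fin 3), (K ρ : ℂ) * G ρ ψ) (∑ ρ, (K ρ : ℂ) * deriv (G ρ) ψ) ψ :=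
    fun ψ hψ => HasDerivAt.fun_sum fun ρ _ => ((hGdiff ρ ψ hψ).hasDerivAt).const_mul _
  have hH' : Tendsto (fun ψ => deriv (fun ψ => ∑ ρ : {w : InfinitePlace L // IsComplex w} → Perm (Fin 3), (K ρ : ℂ) * G ρ ψ) ψ) (𝓝[≠] 0)
      (𝓝 (∑ ρ, (K ρ : ℂ) * D ρ)) := by
    refine (tendsto_finsetSum _ fun ρ _ => (hD ρ).const_mul (K ρ : ℂ)).congr' ?_
    filter_upwards [hTev] with ψ hψ
    exact ((hHderiv ψ hψ).deriv).symm
  -- (5) `G = S·H`, `G′ = S′H + SH′`, one side at a time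
  have hS0 : Tendsto S (𝓝[≠] 0) (𝓝 (S 0)) := (hS_smooth.continuous.tendsto 0).mono_left nhdsWithin_le_nhds
  have hS1 : ∀ ψ, HasDerivAt S (deriv S ψ) ψ := fun ψ => ((hS_smooth.differentiable (by simp)) ψ).hasDerivAt
  have hS'0 : Tendsto (fun ψ => deriv S ψ) (𝓝[≠] 0) (𝓝 (deriv S 0)) :=
    ((hS_smooth.continuous_deriv (by exact_mod_cast le_top)).tendsto 0).mono_left nhdsWithin_le_nhds
  have hDev : ∀ᶠ ψ in 𝓝[≠] (0 : ℝ), deriv S ψ * (∑ ρ : {w : InfinitePlace L // IsComplex w} → Perm (Fin 3), (K ρ : ℂ) * G ρ ψ) +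
      S ψ * deriv (fun ψ => ∑ ρ : {w : InfinitePlace L // IsComplex w} → Perm (Fin 3), (K ρ : ℂ) * G ρ ψ) ψ =
        deriv (fun ψ => S ψ * ∑ ρ : {w : InfinitePlace L // IsComplex w} → Perm (Fin 3), (K ρ : ℂ) * G ρ ψ) ψ := by
    filter_upwards [hTev] with ψ hψ
    rw [(hHderiv ψ hψ).deriv]
    exact (((hS1 ψ).fun_mul (hHderiv ψ hψ)).deriv).symm
  refine ⟨S 0 * ∑ ρ, (K ρ : ℂ) * Jp ρ, S 0 * ∑ ρ, (K ρ : ℂ) * Jm ρ,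
    deriv S 0 * (∑ ρ, (K ρ : ℂ) * Jp ρ) + S 0 * ∑ ρ, (K ρ : ℂ) * D ρ, deriv S 0 * (∑ ρ, (K ρ : ℂ) * Jm ρ) + S 0 * ∑ ρ, (K ρ : ℂ) * D ρ,
    (hS0.mono_left hGT).mul hHp, (hS0.mono_left hLT).mul hHm, ?_, ?_⟩
  · exact (((hS'0.mono_left hGT).mul hHp).add ((hS0.mono_left hGT).mul (hH'.mono_left hGT))).congr' (hDev.filter_mono hGT)
  · exact (((hS'0.mono_left hLT).mul hHm).add ((hS0.mono_left hLT).mul (hH'.mono_left hLT))).congr' (hDev.filter_mono hLT)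

include hγH in
open scoped Classical in
/-- **(M3-pre) — ACROSS THE `H`-WALL AT ANY PLACE, `2 sin ψ · (Δ″-side)` HAS ONE-SIDED LIMITS OF ORDERS 0 AND 1.**  Base `z` regular off `w`, `z_{w,0} = z_{w,2} ≠ z_{w,1}`,
`μ|_{𝔸_{L⁺}^×} = ω`; `G(ψ) = 2 sin ψ · Σ_ρ Δ″(γ_H(z^ψ), t(z^ψ∘ρ))·∫_{G′_∞} Θ(↑↑(g·t(z^ψ∘ρ)·g⁻¹)) dν_∞`: there are `Jp Jm Bp Bm` with `G → Jp∕Jm` and `G′ → Bp∕Bm` as `ψ → 0±`.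
(The jump `Jp − Jm = S(0)·Σ_ρ K_ρ(Jp_ρ − Jm_ρ)` is the `H`-side datum of (M3); at a definite place it vanishes: ★ `ArchEndoscopicTransferSmoothDefinitePlace`.)
[cite: Rogawski1990, §8.2 pp. 122–124; §4.9 p. 55] [cite: Shelstad1979, §4] [cite: Varadarajan1989, §6.4 Thm 18, Thm 20, Thm 22] -/
theorem exists_tendsto_two_sin_mul_sum_archExplicitDelta_mul_integral_splitCurve_hWall
    (νw : ∀ v : {w : InfinitePlace L // IsComplex w}, Measure (archLocal L 3 (Matrix.diagonal α) v)) [∀ v, (νw v).IsHaarMeasure]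
    (hα : ∀ i, α i ≠ 0) (hherm : ∀ i, (IsCMField.complexConj L (α i) : L) = α i)
    (hμω : ∀ x : ideleGroup ↥(maximalRealSubfield L), μ (AdeleRing.ideleBaseChange (↥(maximalRealSubfield L)) L x) = quadraticHeckeCharCM L x)
    (Θ : Matrix (Fin 3) (Fin 3) (mixedSpace L) → ℂ) (hΘ : ContDiff ℝ (⊤ : ℕ∞) Θ)
    (hΘc : HasCompactSupport fun g : arch (↥(maximalRealSubfield L)) L (IsCMField.complexConj L) 3 (Matrix.diagonal α) => Θ ((g : GL (Fin 3) (mixedSpace L)) : Matrix (Fin 3) (Fin 3) (mixedSpace L)))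
    (z : {w : InfinitePlace L // IsComplex w} → Fin 3 → Circle) (hz : ∀ v, v ≠ w → Function.Injective (z v)) (h02 : z w 0 = z w 2) (h01 : z w 0 ≠ z w 1) :
    ∃ Jp Jm Bp Bm : ℂ,
      Tendsto (fun ψ : ℝ => (2 * Real.sin ψ : ℂ) * ∑ ρ : {w : InfinitePlace L // IsComplex w} → Perm (Fin 3),
          archExplicitDelta L (Matrix.diagonal α) (γH fun v => Function.update z w (fun i => z w i * Circle.exp (![(1 : ℝ), 0, -1] i * ψ)) v) μ (archDiagTorus L 3 α fun v => Function.update z w (fun i => z w i * Circle.exp (![(1 : ℝ), 0, -1] i * ψ)) v ∘ ⇑(ρ v)) *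
            ∫ g, Θ (((g * archDiagTorus L 3 α (fun v => Function.update z w (fun i => z w i * Circle.exp (![(1 : ℝ), 0, -1] i * ψ)) v ∘ ⇑(ρ v)) * g⁻¹ :
              arch (↥(maximalRealSubfield L)) L (IsCMField.complexConj L) 3 (Matrix.diagonal α)) : GL (Fin 3) (mixedSpace L)) : Matrix (Fin 3) (Fin 3) (mixedSpace L))
              ∂((Measure.pi νw).map (archPiEquivCM 3 L (Matrix.diagonal α)).symm)) (𝓝[>] 0) (𝓝 Jp) ∧
      Tendsto (fun ψ : ℝ => (2 * Real.sin ψ : ℂ) * ∑ ρ : {w : InfinitePlace L // IsComplex w} → Perm (Fin 3),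
          archExplicitDelta L (Matrix.diagonal α) (γH fun v => Function.update z w (fun i => z w i * Circle.exp (![(1 : ℝ), 0, -1] i * ψ)) v) μ (archDiagTorus L 3 α fun v => Function.update z w (fun i => z w i * Circle.exp (![(1 : ℝ), 0, -1] i * ψ)) v ∘ ⇑(ρ v)) *
            ∫ g, Θ (((g * archDiagTorus L 3 α (fun v => Function.update z w (fun i => z w i * Circle.exp (![(1 : ℝ), 0, -1] i * ψ)) v ∘ ⇑(ρ v)) * g⁻¹ :
              arch (↥(maximalRealSubfield L)) L (IsCMField.complexConj L) 3 (Matrix.diagonal α)) : GL (Fin 3) (mixedSpace L)) : Matrix (Fin 3) (Fin 3) (mixedSpace L))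
              ∂((Measure.pi νw).map (archPiEquivCM 3 L (Matrix.diagonal α)).symm)) (𝓝[<] 0) (𝓝 Jm) ∧
      Tendsto (fun ψ : ℝ => deriv (fun ψ : ℝ => (2 * Real.sin ψ : ℂ) * ∑ ρ : {w : InfinitePlace L // IsComplex w} → Perm (Fin 3),
          archExplicitDelta L (Matrix.diagonal α) (γH fun v => Function.update z w (fun i => z w i * Circle.exp (![(1 : ℝ), 0, -1] i * ψ)) v) μ (archDiagTorus L 3 α fun v => Function.update z w (fun i => z w i * Circle.exp (![(1 : ℝ), 0, -1] i * ψ)) v ∘ ⇑(ρ v)) *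
            ∫ g, Θ (((g * archDiagTorus L 3 α (fun v => Function.update z w (fun i => z w i * Circle.exp (![(1 : ℝ), 0, -1] i * ψ)) v ∘ ⇑(ρ v)) * g⁻¹ :
              arch (↥(maximalRealSubfield L)) L (IsCMField.complexConj L) 3 (Matrix.diagonal α)) : GL (Fin 3) (mixedSpace L)) : Matrix (Fin 3) (Fin 3) (mixedSpace L))
              ∂((Measure.pi νw).map (archPiEquivCM 3 L (Matrix.diagonal α)).symm)) ψ) (𝓝[>] 0) (𝓝 Bp) ∧
      Tendsto (fun ψ : ℝ => deriv (fun ψ : ℝ => (2 * Real.sin ψ : ℂ) * ∑ ρ : {w : InfinitePlace L // IsComplex w} → Perm (Fin 3),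
          archExplicitDelta L (Matrix.diagonal α) (γH fun v => Function.update z w (fun i => z w i * Circle.exp (![(1 : ℝ), 0, -1] i * ψ)) v) μ (archDiagTorus L 3 α fun v => Function.update z w (fun i => z w i * Circle.exp (![(1 : ℝ), 0, -1] i * ψ)) v ∘ ⇑(ρ v)) *
            ∫ g, Θ (((g * archDiagTorus L 3 α (fun v => Function.update z w (fun i => z w i * Circle.exp (![(1 : ℝ), 0, -1] i * ψ)) v ∘ ⇑(ρ v)) * g⁻¹ :
              arch (↥(maximalRealSubfield L)) L (IsCMField.complexConj L) 3 (Matrix.diagonal α)) : GL (Fin 3) (mixedSpace L)) : Matrix (Fin 3) (Fin 3) (mixedSpace L))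
              ∂((Measure.pi νw).map (archPiEquivCM 3 L (Matrix.diagonal α)).symm)) ψ) (𝓝[<] 0) (𝓝 Bm) :=
  exists_tendsto_two_sin_mul_sum_archExplicitDelta_mul_integral_splitCurve_hWall_aux L α w γH hγH μ νw hα hherm hμω Θ hΘ hΘc z hz h02 h01 _ rfl

end HWall

end Literature.NumberTheory.Rogawski1990

end
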